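import Summits.ABC.IUTFork.LDHGenuineUnionPrintIsm
import HarnessLib

/-!
# The fork at [IUTchIII] Corollary 3.12, L-DH level, with (Ind2) := PRINT's factorwise `Ism`: the readings are DECIDED at every genuine datum —
# the inequality holds IFF the datum is Szpiro-SHALLOW, `((l+1)/24 − 1/(2l))·log q^{∤{2,l}}(λ) ≤ ((l+5)/4)·log π`
# (abc-iut cell, crux ThetaPartII = stmt-ABC-19678; row «C:PERIMAGE-PRINT-ISM», part 7: the exact criterion)

Record-only PROOF file (D-0012; no definition, no `Prop` fact) of the abc-iut cell (WAVE-3 discharge seat abc-iut-c312-d1, gen 11; sequel of parts 2 and 5,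
`LDHGenuinePerImagePrintIsm` p510764 / `LDHGenuineUnionPrintIsm` p515344). TAKES NO SIDE on [IUTchIII] Cor. 3.12.

Parts 2 and 5 computed the Θ-side of the cell's readings (P) and (U) of [IUTchIII] Cor. 3.12 over any family `H` of packet automorphisms DOMINATED BY
PRINT's (Ind2) (factorwise abc-iut-c312-1 `Real.ismIsm (analyticLogv K) v̲_b` = `ℤ_p^×·id`, abc-iut-w5-d216 p452975): it is EXACTLY the bare value
`−deĝ̲_lgp(P_Θ)` ((P): every input; (U): `[F_mod : ℚ] = 1`). So the inequality `−|log(q)| ≤ [Θ-side over H] + ((l+5)/4)·log π` is EQUIVALENT to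
the pure arithmetic of the pilot degrees — no hull, no indeterminacy left:

* `printInd2_of_mem_closure` — the subgroup GENERATED by the factorwise print-(Ind2) automorphisms of a genuine packet is again print-dominated
  (so every statement of this row applies to `H :=` that subgroup: generators are unit homotheties, which form a group, part 1);
* **`ThetaVolumeInput.perImage_printInd2_iff_gap_le_arch`** — for every genuine input `I` and every print-dominated `H`:
  `(−|log(q)| ≤ [(P)-Θ-side over H] + ((l+5)/4)·log π) ↔ deĝ̲_lgp(P_Θ) − deĝ̲(P_q) ≤ ((l+5)/4)·log π`;
  **`ThetaVolumeInput.union_printInd2_iff_gap_le_arch_of_finrank_eq_one`** — the same for reading (U) when `[F₀ : ℚ] = 1`;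
* **`Cor22.ThetaVolumeDatumAt.perImage_printInd2_iff_shallow`** — at the Θ-data of a point `P ∈ U`: for every genuine datum `T` and print-dominated `H`,
  the (P)-inequality over `H` holds **iff** `((l+1)/24 − 1/(2l))·log q^{∤{2,l}}(λ_P) ≤ ((l+5)/4)·log π` (this lineage's gen-6 SHALLOW regime,
  `cor312PerImageAtDatum_of_shallow`, now an EQUIVALENCE under print's (Ind2)); **`…union_printInd2_iff_shallow_of_j_mem_range`** — the same
  for reading (U) at data with rational `j`-invariant.

READING (numbers about OUR typed objects; the C LEAD's words decide the booking): under PRINT's (Ind2) as typed by c312-1 the cell's Corollary at a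
genuine datum is DECIDED by one explicit inequality in `log q^{∤{2,l}}(λ)` alone — TRUE exactly in the Szpiro-shallow regime `log q^{∤{2,l}}(λ) ≤
6l(l+5)/((l+4)(l−3))·log π` (`≈ 13.1` at `l = 7`, `→ 6·log π ≈ 6.9`), FALSE beyond it (every tabulated Szpiro-bad datum has `log q^{∤2l} > 40`): the
(Ind2)-as-`Ism` reading carries no information beyond the bare pilot degrees, in kernel. The gain of record (different + shell) lives in the
Dupuy–Hilado container outside `ℤ_p^×`, or in print's (Ind1) strip part (row «C:PERIMAGE-PRINT-IND1», abc-iut-c312-1); F-B28-1's reading matter,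
(Ind3), the log-link and Cor. 3.12 itself are untouched; decided-as-typed ≠ decided in print; nothing here asserts that abc is proved or refuted;
no side taken. [cite: Mochizuki2012, IUTchIII Cor. 3.12 p. 173–174; proof Step (x) p. 181; Thm. 3.11 (i) p. 154] [cite: Mochizuki2012, IUTchIV
Thm. 1.10 Steps (v)–(viii) p. 27–31] [cite: DupuyHilado2025, §4.7, §4.9, §4.12, Thm. 3.10.1] [claim: Mochizuki2012, status: disputed] for every
IUT quotation. Axioms: standard three.
-/

noncomputable section

open NumberField IsDedekindDomain

/-! ## 0. The subgroup GENERATED by print's factorwise (Ind2) is again print-dominated -/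

namespace Summit.ABC.IUTFork

open Literature.IUT.LogVolume Literature.NumberTheory.NumberFields Thm311.Real

section Closure

variable {F₀ : Type} [Field F₀] [NumberField F₀] {K : Type} [Field K] [NumberField K] [Algebra F₀ K]
variable (σ : PlaceSection F₀ K) (p : ℕ) [hp : Fact p.Prime]

/-- **CLOSURE: every element of the subgroup GENERATED by the factorwise print-(Ind2) automorphisms of a genuine packet acts factorwise through
print's (Ind2)** — so the hypothesis `hH` of this row holds for `H :=` the subgroup generated by [IUTchIII] Thm. 3.11 (i)'s «independent copies of
Ism … on each of the direct summands» (part 1: the generators are unit homotheties, unit homotheties form a group, and every unit homothety is a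
factorwise print family, `exists_printInd2_of_unit`). [cite: Mochizuki2012, IUTchIII Thm. 3.11 (i) p. 154] [cite: Mochizuki2012, IUTchII Ex. 1.8 (iv) p. 39]
[claim: Mochizuki2012, status: disputed] -/
theorem printInd2_of_mem_closure {j : ℕ} (e : Fin (j + 1) → placesOver F₀ p)
    {g : PacketAlgebra p (fun b => (σ.localFields p).k (e b)) ≃ₗ[ℚ_[p]] PacketAlgebra p (fun b => (σ.localFields p).k (e b))}
    (hg : g ∈ Subgroup.closure
      {g : PacketAlgebra p (fun b => (σ.localFields p).k (e b)) ≃ₗ[ℚ_[p]] PacketAlgebra p (fun b => (σ.localFields p).k (e b)) |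
        ∃ ψ : ∀ b : Fin (j + 1), Carrier (.inr (σ.lift (e b).1) : Thm311.Real.Place K) ≃ₗ[ℚ]
            Carrier (.inr (σ.lift (e b).1) : Thm311.Real.Place K),
          (∀ b, ψ b ∈ ismIsm (analyticLogv K) (σ.lift (e b).1)) ∧
          ∀ x : ∀ b, (σ.localFields p).k (e b),
            g (PiTensorProduct.tprod ℚ_[p] x) =
              PiTensorProduct.tprod ℚ_[p] (fun b =>
                RescaledCompletion.of K p (σ.lift (e b).1) (σ.natCast_mem_lift (e b))
                  (ψ b ((RescaledCompletion.of K p (σ.lift (e b).1) (σ.natCast_mem_lift (e b))).symm (x b))))}) :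
    ∃ ψ : ∀ b : Fin (j + 1), Carrier (.inr (σ.lift (e b).1) : Thm311.Real.Place K) ≃ₗ[ℚ]
        Carrier (.inr (σ.lift (e b).1) : Thm311.Real.Place K),
      (∀ b, ψ b ∈ ismIsm (analyticLogv K) (σ.lift (e b).1)) ∧
      ∀ x : ∀ b, (σ.localFields p).k (e b),
        g (PiTensorProduct.tprod ℚ_[p] x) =
          PiTensorProduct.tprod ℚ_[p] (fun b =>
            RescaledCompletion.of K p (σ.lift (e b).1) (σ.natCast_mem_lift (e b))
              (ψ b ((RescaledCompletion.of K p (σ.lift (e b).1) (σ.natCast_mem_lift (e b))).symm (x b)))) := by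
  -- every element of the closure is a unit homothety …
  have hunit : ∀ g' ∈ Subgroup.closure
      {g : PacketAlgebra p (fun b => (σ.localFields p).k (e b)) ≃ₗ[ℚ_[p]] PacketAlgebra p (fun b => (σ.localFields p).k (e b)) |
        ∃ ψ : ∀ b : Fin (j + 1), Carrier (.inr (σ.lift (e b).1) : Thm311.Real.Place K) ≃ₗ[ℚ]
            Carrier (.inr (σ.lift (e b).1) : Thm311.Real.Place K),
          (∀ b, ψ b ∈ ismIsm (analyticLogv K) (σ.lift (e b).1)) ∧
          ∀ x : ∀ b, (σ.localFields p).k (e b),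
            g (PiTensorProduct.tprod ℚ_[p] x) =
              PiTensorProduct.tprod ℚ_[p] (fun b =>
                RescaledCompletion.of K p (σ.lift (e b).1) (σ.natCast_mem_lift (e b))
                  (ψ b ((RescaledCompletion.of K p (σ.lift (e b).1) (σ.natCast_mem_lift (e b))).symm (x b))))},
      ∃ u : ℚ_[p], ‖u‖ = 1 ∧ ∀ y, g' y = u • y := by
    intro g' hg'
    refine Subgroup.closure_induction (fun g₀ hg₀ => ?_) ?_ (fun g₁ g₂ _ _ h₁ h₂ => ?_) (fun g₁ _ h₁ => ?_) hg'
    · obtain ⟨ψ, hψ, hgψ⟩ := hg₀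
      exact exists_unit_smul_of_printInd2 p (fun b => σ.lift (e b).1) (fun b => σ.natCast_mem_lift (e b)) ψ hψ g₀ hgψ
    · exact ⟨1, norm_one, fun y => by rw [one_smul]; rfl⟩
    · obtain ⟨u₁, hu₁, h₁⟩ := h₁
      obtain ⟨u₂, hu₂, h₂⟩ := h₂
      refine ⟨u₁ * u₂, by rw [norm_mul, hu₁, hu₂, mul_one], fun y => ?_⟩
      rw [LinearEquiv.mul_apply, h₂, map_smul, h₁, smul_smul, mul_comm]
    · obtain ⟨u, hu, h⟩ := h₁
      have hu0 : u ≠ 0 := norm_ne_zero_iff.mp (by rw [hu]; exact one_ne_zero)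
      refine ⟨u⁻¹, by rw [norm_inv, hu, inv_one], fun y => ?_⟩
      have hy : g₁ (g₁⁻¹ y) = y := by rw [← LinearEquiv.mul_apply, mul_inv_cancel]; rfl
      rw [h] at hy
      calc g₁⁻¹ y = u⁻¹ • (u • g₁⁻¹ y) := by rw [smul_smul, inv_mul_cancel₀ hu0, one_smul]
        _ = u⁻¹ • y := by rw [hy]
  -- … and every unit homothety is a factorwise print family (part 1)
  obtain ⟨u, hu, hgu⟩ := hunit g hg
  obtain ⟨ψ, hψ, hψu⟩ := exists_printInd2_of_unit p (fun b => σ.lift (e b).1) (fun b => σ.natCast_mem_lift (e b)) (0 : Fin (j + 1)) hu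
  exact ⟨ψ, hψ, fun x => (hgu _).trans (hψu x).symm⟩

end Closure

end Summit.ABC.IUTFork

namespace Literature.IUT.LogVolume

open Summit.ABC.IUTFork Summit.ABC.IUTFork.Thm311.Real Literature.NumberTheory.NumberFields

namespace ThetaVolumeInput

variable {F₀ : Type} [Field F₀] [NumberField F₀] {K : Type} [Field K] [NumberField K] [Algebra F₀ K]
variable (I : ThetaVolumeInput F₀ K)

/-- **Reading (P) over PRINT's (Ind2) ⟺ `gap ≤ arch`**: for every genuine input and every print-dominated `H`, the per-image inequality with
Θ-side over `H` holds iff `deĝ̲_lgp(P_Θ) − deĝ̲(P_q) ≤ ((l+5)/4)·log π` (part 2's `sum_lnνLp_hull_printInd2_eq_neg_ndegLgp`: the Θ-side IS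
`−deĝ̲_lgp(P_Θ)`). [cite: Mochizuki2012, IUTchIII Cor. 3.12 proof Step (x) p. 181] [cite: DupuyHilado2025, Thm. 3.10.1] [claim: Mochizuki2012, status: disputed] -/
theorem perImage_printInd2_iff_gap_le_arch
    (H : (p : ℕ) → (hp : p.Prime) → (j : ℕ) → (e : Fin (j + 1) → placesOver F₀ p) →
      haveI : Fact p.Prime := ⟨hp⟩
      Subgroup (PacketAlgebra p (fun b => (I.σ.localFields p).k (e b)) ≃ₗ[ℚ_[p]]
        PacketAlgebra p (fun b => (I.σ.localFields p).k (e b))))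
    (hH : ∀ (p : ℕ) (hp : p.Prime), haveI : Fact p.Prime := ⟨hp⟩
      ∀ j e, ∀ g ∈ H p hp j e,
        ∃ ψ : ∀ b : Fin (j + 1), Carrier (.inr (I.σ.lift (e b).1) : Thm311.Real.Place K) ≃ₗ[ℚ]
            Carrier (.inr (I.σ.lift (e b).1) : Thm311.Real.Place K),
          (∀ b, ψ b ∈ ismIsm (analyticLogv K) (I.σ.lift (e b).1)) ∧
          ∀ x : ∀ b, (I.σ.localFields p).k (e b),
            (g : PacketAlgebra p (fun b => (I.σ.localFields p).k (e b)) ≃ₗ[ℚ_[p]]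
                PacketAlgebra p (fun b => (I.σ.localFields p).k (e b))) (PiTensorProduct.tprod ℚ_[p] x) =
              PiTensorProduct.tprod ℚ_[p] (fun b =>
                RescaledCompletion.of K p (I.σ.lift (e b).1) (I.σ.natCast_mem_lift (e b))
                  (ψ b ((RescaledCompletion.of K p (I.σ.lift (e b).1) (I.σ.natCast_mem_lift (e b))).symm (x b))))) :
    (I.negAbsLogQ ≤
      (∑ p ∈ I.supportPrimes,
        if hp : p.Prime then
          (haveI : Fact p.Prime := ⟨hp⟩
           (I.packetAt p hp).lnνLp I.lstar (fun j e =>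
             packetHull p (fun b => (I.σ.localFields p).k (e b))
               (⋃ g : H p hp j e, (g : PacketAlgebra p (fun b => (I.σ.localFields p).k (e b)) ≃ₗ[ℚ_[p]]
                   PacketAlgebra p (fun b => (I.σ.localFields p).k (e b))) ''
                 (I.packetAt p hp).pilotRegion (I.tΘ p hp) j e)))
        else 0) + archLogTheta I.l) ↔
      LgpDivisor.ndegLgp I.X.thetaPilot - FinDivisor.ndeg F₀ I.X.qPilot ≤ archLogTheta I.l := by
  rw [I.sum_lnνLp_hull_printInd2_eq_neg_ndegLgp H hH]
  unfold negAbsLogQ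
  constructor <;> intro h <;> linarith

/-- **Reading (U) over PRINT's (Ind2) ⟺ `gap ≤ arch`, for `[F₀ : ℚ] = 1`** (part 5's `sum_lnνLp_hull_printInd2_union_eq_neg_ndegLgp_of_finrank_eq_one`).
[cite: Mochizuki2012, IUTchIII Cor. 3.12 p. 174] [cite: DupuyHilado2025, §4.7, Thm. 3.10.1] [claim: Mochizuki2012, status: disputed] -/
theorem union_printInd2_iff_gap_le_arch_of_finrank_eq_one (hF : Module.finrank ℚ F₀ = 1)
    (H : (p : ℕ) → (hp : p.Prime) → (j : ℕ) → (e : Fin (j + 1) → placesOver F₀ p) →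
      haveI : Fact p.Prime := ⟨hp⟩
      Subgroup (PacketAlgebra p (fun b => (I.σ.localFields p).k (e b)) ≃ₗ[ℚ_[p]]
        PacketAlgebra p (fun b => (I.σ.localFields p).k (e b))))
    (hH : ∀ (p : ℕ) (hp : p.Prime), haveI : Fact p.Prime := ⟨hp⟩
      ∀ j e, ∀ g ∈ H p hp j e,
        ∃ ψ : ∀ b : Fin (j + 1), Carrier (.inr (I.σ.lift (e b).1) : Thm311.Real.Place K) ≃ₗ[ℚ]
            Carrier (.inr (I.σ.lift (e b).1) : Thm311.Real.Place K),
          (∀ b, ψ b ∈ ismIsm (analyticLogv K) (I.σ.lift (e b).1)) ∧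
          ∀ x : ∀ b, (I.σ.localFields p).k (e b),
            (g : PacketAlgebra p (fun b => (I.σ.localFields p).k (e b)) ≃ₗ[ℚ_[p]]
                PacketAlgebra p (fun b => (I.σ.localFields p).k (e b))) (PiTensorProduct.tprod ℚ_[p] x) =
              PiTensorProduct.tprod ℚ_[p] (fun b =>
                RescaledCompletion.of K p (I.σ.lift (e b).1) (I.σ.natCast_mem_lift (e b))
                  (ψ b ((RescaledCompletion.of K p (I.σ.lift (e b).1) (I.σ.natCast_mem_lift (e b))).symm (x b))))) :
    (I.negAbsLogQ ≤
      (∑ p ∈ I.supportPrimes,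
        if hp : p.Prime then
          (haveI : Fact p.Prime := ⟨hp⟩
           (I.packetAt p hp).lnνLp I.lstar (fun j e =>
             packetHull p (fun b => (I.σ.localFields p).k (e b))
               (⋃ g : H p hp j e, (g : PacketAlgebra p (fun b => (I.σ.localFields p).k (e b)) ≃ₗ[ℚ_[p]]
                   PacketAlgebra p (fun b => (I.σ.localFields p).k (e b))) ''
                 ⋃ τ : Equiv.Perm (Fin (j + 1)), (I.packetAt p hp).perm τ e ''
                   (I.packetAt p hp).pilotRegion (I.tΘ p hp) j (e ∘ τ))))
        else 0) + archLogTheta I.l) ↔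
      LgpDivisor.ndegLgp I.X.thetaPilot - FinDivisor.ndeg F₀ I.X.qPilot ≤ archLogTheta I.l := by
  rw [I.sum_lnνLp_hull_printInd2_union_eq_neg_ndegLgp_of_finrank_eq_one hF H hH]
  unfold negAbsLogQ
  constructor <;> intro h <;> linarith

end ThetaVolumeInput

/-! ## At the Θ-data of a point: the print-Ism readings are DECIDED by the shallow inequality -/

namespace Cor22

namespace ThetaVolumeDatumAt

open Literature.NumberTheory.DiophantineGeometry.GenEll

variable {P : NFPoint} {l : ℕ} (T : ThetaVolumeDatumAt P l)

/-- **DECIDED: reading (P) over PRINT's (Ind2) at a genuine datum of `(P, l)`, `λ_P ∈ U`, holds IFF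
`((l+1)/24 − 1/(2l))·log q^{∤{2,l}}(λ_P) ≤ ((l+5)/4)·log π`** — the Szpiro-SHALLOW condition of this lineage's gen 6 (`cor312PerImageAtDatum_of_shallow`),
now an equivalence: under print's factorwise `Ism` the Θ-side is the bare `−deĝ̲_lgp(P_Θ)` and the gap is `κ_l·log q^{∤2l}(λ)` (`PointDict.gap_eq`).
[cite: Mochizuki2012, IUTchIII Cor. 3.12 p. 173–174; proof Step (x) p. 181] [cite: Mochizuki2012, IUTchIV Thm. 1.10 Step (viii) p. 30]
[claim: Mochizuki2012, status: disputed] -/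
theorem perImage_printInd2_iff_shallow (hU : P.InU) :
    letI := T.instFieldF; letI := T.instNumberFieldF; letI := T.instFieldK; letI := T.instNumberFieldK
    letI := T.instAlgebraK; letI := T.instIsElliptic
    ∀ (H : (p : ℕ) → (hp : p.Prime) → (j : ℕ) →
        (e : Fin (j + 1) → placesOver (Literature.IUT.HodgeTheaters.fieldOfModuli T.E) p) →
        haveI : Fact p.Prime := ⟨hp⟩
        Subgroup (PacketAlgebra p (fun b => (T.I.σ.localFields p).k (e b)) ≃ₗ[ℚ_[p]]
          PacketAlgebra p (fun b => (T.I.σ.localFields p).k (e b)))),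
      (∀ (p : ℕ) (hp : p.Prime), haveI : Fact p.Prime := ⟨hp⟩
        ∀ j e, ∀ g ∈ H p hp j e,
          ∃ ψ : ∀ b : Fin (j + 1), Carrier (.inr (T.I.σ.lift (e b).1) : Thm311.Real.Place T.K) ≃ₗ[ℚ]
              Carrier (.inr (T.I.σ.lift (e b).1) : Thm311.Real.Place T.K),
            (∀ b, ψ b ∈ ismIsm (analyticLogv T.K) (T.I.σ.lift (e b).1)) ∧
            ∀ x : ∀ b, (T.I.σ.localFields p).k (e b),
              (g : PacketAlgebra p (fun b => (T.I.σ.localFields p).k (e b)) ≃ₗ[ℚ_[p]]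
                  PacketAlgebra p (fun b => (T.I.σ.localFields p).k (e b))) (PiTensorProduct.tprod ℚ_[p] x) =
                PiTensorProduct.tprod ℚ_[p] (fun b =>
                  RescaledCompletion.of T.K p (T.I.σ.lift (e b).1) (T.I.σ.natCast_mem_lift (e b))
                    (ψ b ((RescaledCompletion.of T.K p (T.I.σ.lift (e b).1) (T.I.σ.natCast_mem_lift (e b))).symm (x b))))) →
      ((T.negAbsLogQ ≤
          (∑ p ∈ T.I.supportPrimes,
            if hp : p.Prime then
              (haveI : Fact p.Prime := ⟨hp⟩
               (T.I.packetAt p hp).lnνLp T.I.lstar (fun j e =>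
                 packetHull p (fun b => (T.I.σ.localFields p).k (e b))
                   (⋃ g : H p hp j e, (g : PacketAlgebra p (fun b => (T.I.σ.localFields p).k (e b)) ≃ₗ[ℚ_[p]]
                       PacketAlgebra p (fun b => (T.I.σ.localFields p).k (e b))) ''
                     (T.I.packetAt p hp).pilotRegion (T.I.tΘ p hp) j e)))
            else 0) + ThetaVolumeInput.archLogTheta l) ↔
        (((l : ℝ) + 1) / 24 - 1 / (2 * l)) * logQAvoid P {2, l} ≤ ((l : ℝ) + 5) / 4 * Real.log Real.pi) := by
  letI := T.instFieldF; letI := T.instNumberFieldF; letI := T.instFieldK; letI := T.instNumberFieldK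
  letI := T.instAlgebraK; letI := T.instIsElliptic
  intro H hH
  have hl' : ThetaVolumeInput.archLogTheta T.I.l = ThetaVolumeInput.archLogTheta l := by rw [T.l_eq]
  have harch : ThetaVolumeInput.archLogTheta l = ((l : ℝ) + 5) / 4 * Real.log Real.pi := rfl
  have hg : T.gap = LgpDivisor.ndegLgp T.I.X.thetaPilot - FinDivisor.ndeg _ T.I.X.qPilot := rfl
  have key := T.I.perImage_printInd2_iff_gap_le_arch H hH
  rw [hl', ← hg, PointDict.gap_eq T hU, harch] at key
  exact key

/-- **DECIDED: reading (U) over PRINT's (Ind2) at a genuine datum with RATIONAL `j`-invariant** (`j(E_F) ∈ ℚ`, so `[F_mod : ℚ] = 1`): the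
(U)-inequality over a print-dominated `H` holds IFF `((l+1)/24 − 1/(2l))·log q^{∤{2,l}}(λ_P) ≤ ((l+5)/4)·log π`.
[cite: Mochizuki2012, IUTchIII Cor. 3.12 p. 174] [cite: Mochizuki2012, IUTchIV Thm. 1.10 Step (v) p. 27–28, Step (viii) p. 30]
[claim: Mochizuki2012, status: disputed] -/
theorem union_printInd2_iff_shallow_of_j_mem_range (hU : P.InU)
    (hj : letI := T.instFieldF; letI := T.instNumberFieldF; letI := T.instIsElliptic; T.E.j ∈ Set.range (algebraMap ℚ T.F)) :
    letI := T.instFieldF; letI := T.instNumberFieldF; letI := T.instFieldK; letI := T.instNumberFieldK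
    letI := T.instAlgebraK; letI := T.instIsElliptic
    ∀ (H : (p : ℕ) → (hp : p.Prime) → (j : ℕ) →
        (e : Fin (j + 1) → placesOver (Literature.IUT.HodgeTheaters.fieldOfModuli T.E) p) →
        haveI : Fact p.Prime := ⟨hp⟩
        Subgroup (PacketAlgebra p (fun b => (T.I.σ.localFields p).k (e b)) ≃ₗ[ℚ_[p]]
          PacketAlgebra p (fun b => (T.I.σ.localFields p).k (e b)))),
      (∀ (p : ℕ) (hp : p.Prime), haveI : Fact p.Prime := ⟨hp⟩
        ∀ j e, ∀ g ∈ H p hp j e,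
          ∃ ψ : ∀ b : Fin (j + 1), Carrier (.inr (T.I.σ.lift (e b).1) : Thm311.Real.Place T.K) ≃ₗ[ℚ]
              Carrier (.inr (T.I.σ.lift (e b).1) : Thm311.Real.Place T.K),
            (∀ b, ψ b ∈ ismIsm (analyticLogv T.K) (T.I.σ.lift (e b).1)) ∧
            ∀ x : ∀ b, (T.I.σ.localFields p).k (e b),
              (g : PacketAlgebra p (fun b => (T.I.σ.localFields p).k (e b)) ≃ₗ[ℚ_[p]]
                  PacketAlgebra p (fun b => (T.I.σ.localFields p).k (e b))) (PiTensorProduct.tprod ℚ_[p] x) =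
                PiTensorProduct.tprod ℚ_[p] (fun b =>
                  RescaledCompletion.of T.K p (T.I.σ.lift (e b).1) (T.I.σ.natCast_mem_lift (e b))
                    (ψ b ((RescaledCompletion.of T.K p (T.I.σ.lift (e b).1) (T.I.σ.natCast_mem_lift (e b))).symm (x b))))) →
      ((T.negAbsLogQ ≤
          (∑ p ∈ T.I.supportPrimes,
            if hp : p.Prime then
              (haveI : Fact p.Prime := ⟨hp⟩
               (T.I.packetAt p hp).lnνLp T.I.lstar (fun j e =>
                 packetHull p (fun b => (T.I.σ.localFields p).k (e b))
                   (⋃ g : H p hp j e, (g : PacketAlgebra p (fun b => (T.I.σ.localFields p).k (e b)) ≃ₗ[ℚ_[p]]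
                       PacketAlgebra p (fun b => (T.I.σ.localFields p).k (e b))) ''
                     ⋃ τ : Equiv.Perm (Fin (j + 1)), (T.I.packetAt p hp).perm τ e ''
                       (T.I.packetAt p hp).pilotRegion (T.I.tΘ p hp) j (e ∘ τ))))
            else 0) + ThetaVolumeInput.archLogTheta l) ↔
        (((l : ℝ) + 1) / 24 - 1 / (2 * l)) * logQAvoid P {2, l} ≤ ((l : ℝ) + 5) / 4 * Real.log Real.pi) := by
  letI := T.instFieldF; letI := T.instNumberFieldF; letI := T.instFieldK; letI := T.instNumberFieldK
  letI := T.instAlgebraK; letI := T.instIsElliptic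
  intro H hH
  have hF : Module.finrank ℚ (Literature.IUT.HodgeTheaters.fieldOfModuli T.E) = 1 :=
    InitialThetaData.finrank_fieldOfModuli_eq_one_of_j_mem_range hj
  have hl' : ThetaVolumeInput.archLogTheta T.I.l = ThetaVolumeInput.archLogTheta l := by rw [T.l_eq]
  have harch : ThetaVolumeInput.archLogTheta l = ((l : ℝ) + 5) / 4 * Real.log Real.pi := rfl
  have hg : T.gap = LgpDivisor.ndegLgp T.I.X.thetaPilot - FinDivisor.ndeg _ T.I.X.qPilot := rfl
  have key := T.I.union_printInd2_iff_gap_le_arch_of_finrank_eq_one hF H hH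
  rw [hl', ← hg, PointDict.gap_eq T hU, harch] at key
  exact key

end ThetaVolumeDatumAt

end Cor22

end Literature.IUT.LogVolume

end
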